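import Summits.QuantumFields.YangMills.Theses.UnitScaleTilt
import Summits.QuantumFields.YangMills.Theorems.UnitScaleTiltHistoryTailFirstOrderLocal
import Summits.QuantumFields.YangMills.Theorems.UnitScaleTiltHistoryTailSmallFactor

/-!
# Route `UnitScaleTilt` — crux K2 `HistoryTail` (stmt-QuantumFields-18916): (69)–(71) FOR THE ROUTE'S AVERAGING WITH LOCAL SMALLNESS —
# region form, iteration along nested regions, and the deterministic core of (71), all under WALK-LOCAL plaquette smallness of the averaged
# fields near the regions only (support file; bricks S3a-loc/S3b-loc/S3c-loc of the split card)

Fleet lead `ym-ust-18916-p1` (gen 0); split card `CARD-18916-K2-split.md` (evidence #12/#16).  The global-smallness chain S3a/S3b/S3c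
(`HistoryTailStokesStep` p442112, `HistoryTailStokesIter` p442475, `HistoryTailSmallFactor` p442617/p443057) re-proved with the hypotheses
the composite minimisers of (41) actually satisfy ([Balaban1985UV3] (68) p.273: regularity «on B^j(Λ_j)», i.e. AWAY from the history's
large-field regions): at each level `s < j`, for each plaquette `p` of the region `R_{s+1}` and each of its four bonds `c`, every plaquette of
`Ū^{s}` cornered at a site `walkEnd (emb c₋) v`, `|v| ≤ (d+2)L + 2`, is within `a_s` of `1` (`t_s = ((d+2)L)²a_s/4 ≤ 1/10`, `t_s < δ_N`).
From the local first-order square `HistoryTailFirstOrderLocal.dist1_sq_avgFun_le_loc` and the counting lemma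
`HistoryTailStokesStep.sum_squares_le_of_subset`:
* `sum_dist1_sq_avgFun_le_loc` — `Σ_{p′∈R′}|Ū(∂p′) − 1|² ≤ (1+ε)·L⁴(L^d)⁻¹·Σ_{q∈S}|U(∂q) − 1|² + #R′·(1+ε⁻¹)·(435t²)²`;
* `iter_sum_dist1_sq_le_loc` — the iteration along nested regions (`HistoryTailStokesIter.seq_bound_of_step`);
* `smallFactor_deterministic_loc` — `SU(2)`, `d = 3`: a `θ(K−j)`-large `j`-fold averaged plaquette at `p′` forces
  `(p(g_{K−j})² − β_{K−j}·Rem)/(2Πm) ≤ β_K·Σ_{q∈R_0}(1 − Re tr U(∂q))` whenever `Π_{s<j}(1+ε_s) ≤ Πm`.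

WHAT THIS IS NOT: the regularity profile `a_s` of the minimiser's tower (print's (68)) and the sizing of `Rem` under it (S3d) are inputs here;
nothing of (41)/(47); nothing uses (α).
-/

noncomputable section

open scoped BigOperators Matrix.Norms.L2Operator

namespace Summit.QuantumFields.YangMills.Theorems.HistoryTailSmallFactorLocal

open Literature.MathematicalPhysics.QuantumFieldTheory.Balaban1983to89
open T4Continuum BlockAveraging AveragingRT ExpMeanLog BlockAveragingPlaquetteBound
open B10Eq47AxialChi (shiftN)
open T3ContinuumYM3Torus T3UnitScaleTilt T3UnitLawDensityEML
open T3FinestHeightTail (beta_mul_θBal_sq)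
open Summit.QuantumFields.YangMills.Theorems.AvgActionDefect (one_sub_reTr_eq_half_dist1_sq_su2 deltaSU_fin_two)
open Summit.QuantumFields.YangMills.Theorems.HistoryTailStokesStep (sum_squares_le_of_subset)
open Summit.QuantumFields.YangMills.Theorems.HistoryTailStokesIter (seq_bound_of_step iter_succ_eq)
open Summit.QuantumFields.YangMills.Theorems.HistoryTailSmallFactor (prod_mul_const_eq)
open Summit.QuantumFields.YangMills.Theorems.HistoryTailBoundedHeight (scheme_β_add θBal_nonneg')
open Summit.QuantumFields.YangMills.Theorems.HistoryTailFirstOrderLocal (dist1_sq_avgFun_le_loc)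

/-! ## §1 The region form under walk-local smallness -/

section Region

variable {n : Type*} [Fintype n] [DecidableEq n] [Nonempty n] {P : Params} {j : ℕ}

/-- **ONE STEP OF (69)–(70), REGION FORM, WALK-LOCAL SMALLNESS**: if at every plaquette `p′ ∈ R′` the four bonds of `p′` see only `a`-small
plaquettes of `U` within walk-distance `(d+2)L + 2` of their block centres (`t = ((d+2)L)²a/4 ≤ 1/10`, `t < δ_N`), then for every `ε > 0` and
every finite `S` containing the translated squares under `R′`,
`Σ_{p′∈R′}|Ū(∂p′) − 1|² ≤ (1+ε)·L⁴(L^d)⁻¹·Σ_{q∈S}|U(∂q) − 1|² + #R′·(1+ε⁻¹)·(435t²)²`.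
[cite: Balaban1985UV3, (68)-(70) p.273; Balaban1987RG1, (0.4) p.253] -/
theorem sum_dist1_sq_avgFun_le_loc (hj : j + 1 ≤ P.m + P.K) {a : ℝ} (ha : 0 ≤ a)
    {U : GaugeField P j (Matrix.specialUnitaryGroup n ℂ)}
    (ht : ((((P.d + 2) * P.L : ℕ) : ℝ) ^ 2 / 4) * a ≤ 1 / 10) (hδ : ((((P.d + 2) * P.L : ℕ) : ℝ) ^ 2 / 4) * a < deltaSU n)
    {ε : ℝ} (hε : 0 < ε) (R' : Finset (Plaq P (j + 1))) (S : Finset (Plaq P j))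
    (hloc : ∀ p ∈ R', ∀ c : PBond P (j + 1),
      (c = ⟨p.src, p.μ⟩ ∨ c = ⟨p.src.shift p.μ, p.ν⟩ ∨ c = ⟨p.src.shift p.ν, p.μ⟩ ∨ c = ⟨p.src, p.ν⟩) →
        ∀ v : List (Letter P.d), v.length ≤ (P.d + 2) * P.L + 2 →
          ∀ (a' b' : Fin P.d) (h : a' < b'), dist1 (GaugeField.plaqHol U ⟨walkEnd (emb c.src) v, a', b', h⟩) ≤ a)
    (hS : ∀ p ∈ R', ∀ (r : Fin P.d → Fin P.L), ∀ t ∈ Finset.range P.L, ∀ s ∈ Finset.range P.L,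
      (⟨shiftN (shiftN (Site.blockSite p.src r) p.ν t) p.μ s, p.μ, p.ν, p.hμν⟩ : Plaq P j) ∈ S) :
    ∑ p ∈ R', dist1 (GaugeField.plaqHol (avgFun (expMeanLogSU (n := n)) U) p) ^ 2 ≤
      (1 + ε) * ((P.L : ℝ) ^ 4 * ((P.L : ℝ) ^ P.d)⁻¹) * ∑ q ∈ S, dist1 (GaugeField.plaqHol U q) ^ 2 +
        R'.card * ((1 + ε⁻¹) * (435 * (((((P.d + 2) * P.L : ℕ) : ℝ) ^ 2 / 4) * a) ^ 2) ^ 2) := by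
  have hε1 : 0 ≤ 1 + ε := by linarith
  have hL0 : (0 : ℝ) ≤ (P.L : ℝ) ^ 2 * ((P.L : ℝ) ^ P.d)⁻¹ := by positivity
  have hstep := fun p (hp : p ∈ R') => dist1_sq_avgFun_le_loc (n := n) hj ha ht hδ hε p (hloc p hp)
  refine (Finset.sum_le_sum hstep).trans ?_
  rw [Finset.sum_add_distrib, Finset.sum_const, nsmul_eq_mul, ← Finset.mul_sum]
  refine add_le_add ?_ le_rfl
  have hcount := sum_squares_le_of_subset hj (g := fun q => dist1 (GaugeField.plaqHol U q) ^ 2) (fun q => sq_nonneg _) R' S hS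
  calc (1 + ε) * ((P.L : ℝ) ^ 2 * ((P.L : ℝ) ^ P.d)⁻¹) *
        ∑ p ∈ R', ∑ r : Fin P.d → Fin P.L, ∑ t ∈ Finset.range P.L, ∑ s ∈ Finset.range P.L,
          dist1 (GaugeField.plaqHol U ⟨shiftN (shiftN (Site.blockSite p.src r) p.ν t) p.μ s, p.μ, p.ν, p.hμν⟩) ^ 2
      ≤ (1 + ε) * ((P.L : ℝ) ^ 2 * ((P.L : ℝ) ^ P.d)⁻¹) * ((P.L : ℝ) ^ 2 * ∑ q ∈ S, dist1 (GaugeField.plaqHol U q) ^ 2) :=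
        mul_le_mul_of_nonneg_left hcount (mul_nonneg hε1 hL0)
    _ = (1 + ε) * ((P.L : ℝ) ^ 4 * ((P.L : ℝ) ^ P.d)⁻¹) * ∑ q ∈ S, dist1 (GaugeField.plaqHol U q) ^ 2 := by ring

/-- **THE ITERATION ALONG NESTED REGIONS, WALK-LOCAL SMALLNESS PER LEVEL** (local twin of `HistoryTailStokesIter.iter_sum_dist1_sq_le`):
with `Ū^{s}` the `s`-fold average of `U`, regions `R_s` nested as before and, at each level `s < j`, the walk-local `a_s`-smallness of `Ū^{s}`
around the four bonds of every `p ∈ R_{s+1}`,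
`Σ_{p∈R_j}|Ū^{j}(∂p) − 1|² ≤ (Π_{s<j}(1+ε_s)Λ)·Σ_{q∈R_0}|U(∂q) − 1|² + Σ_{s<j}(Π_{s<u<j}(1+ε_u)Λ)·#R_{s+1}·(1+ε_s⁻¹)·(435t_s²)²`, `Λ = L⁴(L^d)⁻¹`.
[cite: Balaban1985UV3, (68)-(70) p.273; Balaban1987RG1, (0.4) p.253] -/
theorem iter_sum_dist1_sq_le_loc (U : GaugeField P 0 (Matrix.specialUnitaryGroup n ℂ)) (a ε : ℕ → ℝ)
    (R : (s : ℕ) → Finset (Plaq P s)) (j : ℕ) (hj : j ≤ P.m + P.K)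
    (ha : ∀ s, s < j → 0 ≤ a s)
    (ht : ∀ s, s < j → ((((P.d + 2) * P.L : ℕ) : ℝ) ^ 2 / 4) * a s ≤ 1 / 10)
    (hδ : ∀ s, s < j → ((((P.d + 2) * P.L : ℕ) : ℝ) ^ 2 / 4) * a s < deltaSU n)
    (hε : ∀ s, 0 < ε s)
    (hloc : ∀ s, s < j → ∀ p ∈ R (s + 1), ∀ c : PBond P (s + 1),
      (c = ⟨p.src, p.μ⟩ ∨ c = ⟨p.src.shift p.μ, p.ν⟩ ∨ c = ⟨p.src.shift p.ν, p.μ⟩ ∨ c = ⟨p.src, p.ν⟩) →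
        ∀ v : List (Letter P.d), v.length ≤ (P.d + 2) * P.L + 2 →
          ∀ (a' b' : Fin P.d) (h : a' < b'),
            dist1 (GaugeField.plaqHol (Averaging.iter (fun _ => BlockAveraging.blockAvg (expMeanLogSU (n := n))) s U)
              ⟨walkEnd (emb c.src) v, a', b', h⟩) ≤ a s)
    (hR : ∀ s, s < j → ∀ p ∈ R (s + 1), ∀ (r : Fin P.d → Fin P.L), ∀ t ∈ Finset.range P.L, ∀ s' ∈ Finset.range P.L,
      (⟨shiftN (shiftN (Site.blockSite p.src r) p.ν t) p.μ s', p.μ, p.ν, p.hμν⟩ : Plaq P s) ∈ R s) :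
    ∑ p ∈ R j, dist1 (GaugeField.plaqHol (Averaging.iter (fun _ => BlockAveraging.blockAvg (expMeanLogSU (n := n))) j U) p) ^ 2 ≤
      (∏ s ∈ Finset.range j, ((1 + ε s) * ((P.L : ℝ) ^ 4 * ((P.L : ℝ) ^ P.d)⁻¹))) *
          ∑ q ∈ R 0, dist1 (GaugeField.plaqHol U q) ^ 2 +
        ∑ s ∈ Finset.range j, (∏ u ∈ Finset.Ico (s + 1) j, ((1 + ε u) * ((P.L : ℝ) ^ 4 * ((P.L : ℝ) ^ P.d)⁻¹))) *
          ((R (s + 1)).card * ((1 + (ε s)⁻¹) * (435 * (((((P.d + 2) * P.L : ℕ) : ℝ) ^ 2 / 4) * a s) ^ 2) ^ 2)) := by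
  set E : ℕ → ℝ := fun s =>
    ∑ p ∈ R s, dist1 (GaugeField.plaqHol (Averaging.iter (fun _ => BlockAveraging.blockAvg (expMeanLogSU (n := n))) s U) p) ^ 2
    with hE
  set α : ℕ → ℝ := fun s => (1 + ε s) * ((P.L : ℝ) ^ 4 * ((P.L : ℝ) ^ P.d)⁻¹) with hαdef
  set c : ℕ → ℝ := fun s =>
    (R (s + 1)).card * ((1 + (ε s)⁻¹) * (435 * (((((P.d + 2) * P.L : ℕ) : ℝ) ^ 2 / 4) * a s) ^ 2) ^ 2) with hc
  have hα : ∀ s, 0 ≤ α s := fun s => by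
    have := hε s
    simp only [hαdef]
    positivity
  have hstep : ∀ s, s < j → E (s + 1) ≤ α s * E s + c s := by
    intro s hs
    have hs1 : s + 1 ≤ P.m + P.K := by omega
    have h := sum_dist1_sq_avgFun_le_loc (n := n) hs1 (ha s hs) (ht s hs) (hδ s hs) (hε s) (R (s + 1)) (R s) (hloc s hs) (hR s hs)
    simp only [hE, hαdef, hc, iter_succ_eq]
    exact h
  have hmain := seq_bound_of_step E α c hα j hstep
  have hE0 : E 0 = ∑ q ∈ R 0, dist1 (GaugeField.plaqHol U q) ^ 2 := rfl
  rw [hE0] at hmain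
  simpa only [hE, hαdef, hc] using hmain

end Region

/-! ## §2 The deterministic core of (71) under walk-local smallness (`SU(2)`, `d = 3`) -/

section Route

variable (F : T3Family) {γ : ℝ}

/-- **(71) FOR THE ROUTE'S AVERAGING — DETERMINISTIC CORE UNDER WALK-LOCAL SMALLNESS** (local twin of
`HistoryTailSmallFactor.smallFactor_deterministic'`): if the `j`-fold averaged plaquette at `p′` is `θ(K−j)`-large and the averaging tower of
the fine field `U` is walk-locally regular (profile `a_s`) around the nested regions `R_j = {p′} ⊇ … ⊇ R_0`, with `Π_{s<j}(1+ε_s) ≤ Πm`, then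
`(p(g_{K−j})² − β_{K−j}·Rem)/(2Πm) ≤ β_K·Σ_{q∈R_0}(1 − Re tr U(∂q))`. [cite: Balaban1985UV3, (68)-(71) p.273; Balaban1987RG1, (0.4) p.253] -/
theorem smallFactor_deterministic_loc (hγ : 0 < γ) (hγ1 : γ ≤ 1) {b₀ : ℝ} (hb₀ : 0 ≤ b₀) (p₀ : ℝ) {K j : ℕ} (hjK : j ≤ K)
    (p' : Plaq (F.P K) j) (U : GaugeField (F.P K) 0 (Matrix.specialUnitaryGroup (Fin 2) ℂ)) (a ε : ℕ → ℝ)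
    (R : (s : ℕ) → Finset (Plaq (F.P K) s)) (hRj : R j = {p'})
    (ha : ∀ s, s < j → 0 ≤ a s)
    (ht : ∀ s, s < j → ((((3 + 2) * F.L : ℕ) : ℝ) ^ 2 / 4) * a s ≤ 1 / 10)
    (hε : ∀ s, 0 < ε s) {Pm : ℝ} (hprod : ∏ s ∈ Finset.range j, (1 + ε s) ≤ Pm)
    (hloc : ∀ s, s < j → ∀ p ∈ R (s + 1), ∀ c : PBond (F.P K) (s + 1),
      (c = ⟨p.src, p.μ⟩ ∨ c = ⟨p.src.shift p.μ, p.ν⟩ ∨ c = ⟨p.src.shift p.ν, p.μ⟩ ∨ c = ⟨p.src, p.ν⟩) →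
        ∀ v : List (Letter (F.P K).d), v.length ≤ ((F.P K).d + 2) * (F.P K).L + 2 →
          ∀ (a' b' : Fin (F.P K).d) (h : a' < b'),
            dist1 (GaugeField.plaqHol (Averaging.iter (fun _ => BlockAveraging.blockAvg ℰp) s U)
              ⟨walkEnd (emb c.src) v, a', b', h⟩) ≤ a s)
    (hR : ∀ s, s < j → ∀ p ∈ R (s + 1), ∀ (r : Fin (F.P K).d → Fin (F.P K).L), ∀ t ∈ Finset.range (F.P K).L,
      ∀ s' ∈ Finset.range (F.P K).L,
        (⟨shiftN (shiftN (Site.blockSite p.src r) p.ν t) p.μ s', p.μ, p.ν, p.hμν⟩ : Plaq (F.P K) s) ∈ R s)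
    (hlarge : θBal F.L γ b₀ p₀ (K - j) ≤
      dist1 (GaugeField.plaqHol (Averaging.iter (fun _ => BlockAveraging.blockAvg ℰp) j U) p')) :
    (B10.pFun b₀ p₀ (Real.sqrt (γ * ((F.L : ℝ)⁻¹) ^ (K - j))) ^ 2 -
        (F.scheme ℰp γ).β (K - j) *
          (∑ s ∈ Finset.range j, (∏ u ∈ Finset.Ico (s + 1) j, ((1 + ε u) * (F.L : ℝ))) *
            ((R (s + 1)).card * ((1 + (ε s)⁻¹) * (435 * (((((3 + 2) * F.L : ℕ) : ℝ) ^ 2 / 4) * a s) ^ 2) ^ 2)))) / (2 * Pm) ≤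
      (F.scheme ℰp γ).β K * ∑ q ∈ R 0, (1 - reTr (GaugeField.plaqHol U q)) := by
  -- names
  set i : ℕ := K - j with hi
  have hK : K = i + j := by omega
  set θ : ℝ := θBal F.L γ b₀ p₀ i with hθ
  set βi : ℝ := (F.scheme ℰp γ).β i with hβi
  set βK : ℝ := (F.scheme ℰp γ).β K with hβK
  set D : ℝ := ∑ q ∈ R 0, dist1 (GaugeField.plaqHol U q) ^ 2 with hD
  set Rem : ℝ := ∑ s ∈ Finset.range j, (∏ u ∈ Finset.Ico (s + 1) j, ((1 + ε u) * (F.L : ℝ))) *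
      ((R (s + 1)).card * ((1 + (ε s)⁻¹) * (435 * (((((3 + 2) * F.L : ℕ) : ℝ) ^ 2 / 4) * a s) ^ 2) ^ 2)) with hRem
  have hL1 : (1 : ℝ) ≤ F.L := by exact_mod_cast F.hL.2.le
  have hβi0 : 0 ≤ βi := F.scheme_β_nonneg ℰp hγ.le i
  have hβK_eq : βK = (F.L : ℝ) ^ j * βi := by rw [hβK, hK, scheme_β_add]
  have hθ0 : 0 ≤ θ := θBal_nonneg' F hγ hγ1 hb₀ p₀ i
  have hβθ : βi * θ ^ 2 = B10.pFun b₀ p₀ (Real.sqrt (γ * ((F.L : ℝ)⁻¹) ^ i)) ^ 2 := beta_mul_θBal_sq F hγ b₀ p₀ i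
  have hP1 : 1 ≤ ∏ s ∈ Finset.range j, (1 + ε s) := by
    calc (1 : ℝ) = ∏ _s ∈ Finset.range j, (1 : ℝ) := Finset.prod_const_one.symm
      _ ≤ ∏ s ∈ Finset.range j, (1 + ε s) :=
          Finset.prod_le_prod (fun _ _ => zero_le_one) fun s _ => by linarith [hε s]
  have hPm : 0 < Pm := lt_of_lt_of_le one_pos (hP1.trans hprod)
  have hd : (F.P K).d = 3 := rfl
  have hΛ : ((F.P K).L : ℝ) ^ 4 * (((F.P K).L : ℝ) ^ (F.P K).d)⁻¹ = F.L := by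
    rw [hd]; show (F.L : ℝ) ^ 4 * ((F.L : ℝ) ^ 3)⁻¹ = F.L; field_simp
  have hδ : ∀ s, s < j → (((((F.P K).d + 2) * (F.P K).L : ℕ) : ℝ) ^ 2 / 4) * a s < deltaSU (Fin 2) := by
    intro s hs; rw [deltaSU_fin_two]; exact (ht s hs).trans_lt (by norm_num)
  have hjmK : j ≤ (F.P K).m + (F.P K).K := by show j ≤ F.m + K; omega
  have hS3b := iter_sum_dist1_sq_le_loc (n := Fin 2) U a ε R j hjmK ha ht hδ hε hloc hR
  rw [hRj, Finset.sum_singleton, hΛ, prod_mul_const_eq] at hS3b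
  have hS3b' : dist1 (GaugeField.plaqHol (Averaging.iter (fun _ => BlockAveraging.blockAvg ℰp) j U) p') ^ 2 ≤
      (∏ s ∈ Finset.range j, (1 + ε s)) * (F.L : ℝ) ^ j * D + Rem := hS3b
  have hsq : θ ^ 2 ≤ dist1 (GaugeField.plaqHol (Averaging.iter (fun _ => BlockAveraging.blockAvg ℰp) j U) p') ^ 2 :=
    pow_le_pow_left₀ hθ0 hlarge 2
  have hD0 : 0 ≤ D := Finset.sum_nonneg fun q _ => sq_nonneg _
  have hLj0 : 0 ≤ (F.L : ℝ) ^ j := by positivity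
  have hmain : θ ^ 2 ≤ Pm * (F.L : ℝ) ^ j * D + Rem := by
    refine hsq.trans (hS3b'.trans ?_)
    have : (∏ s ∈ Finset.range j, (1 + ε s)) * (F.L : ℝ) ^ j * D ≤ Pm * (F.L : ℝ) ^ j * D :=
      mul_le_mul_of_nonneg_right (mul_le_mul_of_nonneg_right hprod hLj0) hD0
    linarith [this]
  have hmul : βi * θ ^ 2 ≤ Pm * βK * D + βi * Rem := by
    have := mul_le_mul_of_nonneg_left hmain hβi0
    rw [hβK_eq]; linarith [this]
  have hDsum : D = 2 * ∑ q ∈ R 0, (1 - reTr (GaugeField.plaqHol U q)) := by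
    rw [hD, Finset.mul_sum]
    exact Finset.sum_congr rfl fun q _ => by rw [one_sub_reTr_eq_half_dist1_sq_su2]; ring
  rw [hβθ, hDsum] at hmul
  rw [div_le_iff₀ (by positivity)]
  linarith [hmul]

end Route

end Summit.QuantumFields.YangMills.Theorems.HistoryTailSmallFactorLocal

end
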